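import Summits.BirchSwinnertonDyer.BirchSwinnertonDyer.Theorems.ClassRecordThreeDefs
import Summits.BirchSwinnertonDyer.BirchSwinnertonDyer.Theorems.ClassRecordThreeHsiehDescentSharp
import Summits.BirchSwinnertonDyer.BirchSwinnertonDyer.Theses.KolyvaginRoadThree
import HarnessLib

/-!
# Route `ClassRecordThree`, crux `HsiehDescentAtThree` (item 19108) — the glue BY NAME for the planner's layer-2
# split: `TateSenCharacterVanishing 3 → (∀ W, ValueReciprocityBAtThree W) → HsiehDescentAtThree`

Cell `bsd-stepL`, seat `bsd-stepL-bdp` (prover g10); `--supports stmt-BirchSwinnertonDyer-19108`. Composition of the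
route object `Theorems.ValueReciprocityBAtThree` (`Theorems/ClassRecordThreeDefs.lean`; the SHARP (VR-B_U)|κ, K5-B)
with the landed sharp reduction `BdpSeat.classRecordThree_hsiehDescentAtThree_of_tateSenCharacter_of_sharpValueReciprocity`
(`Theorems/ClassRecordThreeHsiehDescentSharp.lean`), whose hypothesis `hVR W` is `ValueReciprocityBAtThree W` by `rfl`.
Both route copies of the shared item (`ClassRecordThree` ∕ `KolyvaginRoadThree`) are served (same Prop). CONDITIONAL on
the named fact (NOT asserted) and on the crux (NOT discharged); item 19108 stays OPEN; no class, no census word.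
-/

namespace Summit.BirchSwinnertonDyer.BirchSwinnertonDyer.Theorems

/-- **Item 19108 from its two layer-2 children, by name**: the printed Tate–Sen theorem at `3` (named fact
`Literature.NumberTheory.PAdicHodge.TateSenCharacterVanishing 3`, p414875; hypothesis, NOT asserted) and the sharp
value-reciprocity clause `ValueReciprocityBAtThree W` for every curve imply the crux
`Theses.ClassRecordThree.HsiehDescentAtThree` — by `BdpSeat.classRecordThree_hsiehDescentAtThree_of_tateSenCharacter_of_sharpValueReciprocity`
(definitional unfolding of the def). Glue-by term for `ledger route edit --split HsiehDescentAtThree … --glue-by`.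
[cite: BrinonConrad2009, Thm. 2.2.7] [cite: BertoliniDarmonPrasanna2013, Thm. 5.4 and Lemma 5.3 (shape of the crux only; nothing asserted)] -/
theorem classRecordThree_hsiehDescentAtThree_of_tateSen_of_valueReciprocityB
    (hTS : Literature.NumberTheory.PAdicHodge.TateSenCharacterVanishing 3)
    (hVR : ∀ (W : WeierstrassCurve ℚ) [W.IsElliptic] [W.IsGloballyMinimal], ValueReciprocityBAtThree W) :
    Summit.BirchSwinnertonDyer.BirchSwinnertonDyer.Theses.ClassRecordThree.HsiehDescentAtThree :=
  Summit.BirchSwinnertonDyer.Rank1Residual.X11b.Three.BdpSeat.classRecordThree_hsiehDescentAtThree_of_tateSenCharacter_of_sharpValueReciprocity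
    hTS (fun W _ _ ↦ hVR W)

/-- The same glue with the conclusion read in the SHARED item's `KolyvaginRoadThree` copy (the two route copies of
`HsiehDescentAtThree` are the same `Prop`). [cite: BrinonConrad2009, Thm. 2.2.7] -/
theorem kolyvaginRoadThree_hsiehDescentAtThree_of_tateSen_of_valueReciprocityB
    (hTS : Literature.NumberTheory.PAdicHodge.TateSenCharacterVanishing 3)
    (hVR : ∀ (W : WeierstrassCurve ℚ) [W.IsElliptic] [W.IsGloballyMinimal], ValueReciprocityBAtThree W) :
    Summit.BirchSwinnertonDyer.BirchSwinnertonDyer.Theses.KolyvaginRoadThree.HsiehDescentAtThree :=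
  Summit.BirchSwinnertonDyer.Rank1Residual.X11b.Three.BdpSeat.classRecordThree_hsiehDescentAtThree_of_tateSenCharacter_of_sharpValueReciprocity
    hTS (fun W _ _ ↦ hVR W)

end Summit.BirchSwinnertonDyer.BirchSwinnertonDyer.Theorems
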